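import Mathlib

/-!
# Integer lattice lemmas for the periodic sub-cell of `EC(3,2)` (unimodular completion)

Support lemmas for the **unimodular-reduction task** (seat-1 handoff O21 / task T12 of the
`pub-schanuel` EAC ladder): the periodic half `ECCellPeriodic d` of the first open rung
`EC(d+1, d)` concerns bases `B = cl π(W ∩ Gⁿ)` with an *integer period* `v ∈ ℤⁿ \ {0}`;
the standard reduction (Mantova–Masser 2024 §1, "after a change of coordinates by `GLₙ(ℤ)`
one may assume the period is `eₙ`") needs the folklore fact that a **primitive** integer
vector is a column of a unimodular matrix.  This file proves it over `ℤ` (Mathlib only):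

* `exists_eq_smul_of_span_range` / `exists_eq_smul_primitive`: every nonzero `v : ι → ℤ` is
  `g • v'` with `v'` primitive (`Ideal.span (range v') = ⊤`);
* `exists_basis_apply_eq_of_primitive`: a primitive `v` is a member of a `ℤ`-basis of `ι → ℤ`
  (at any prescribed index);
* `exists_unimodular_mulVec_eq_single`: there is `U ∈ Matₙ(ℤ)` with `IsUnit U.det` and
  `U *ᵥ v = Pi.single i₀ 1`; `exists_unimodular_col_eq`: `v` is the `i₀`-th column of a
  unimodular matrix.

Honest placement: pure linear algebra over `ℤ`; nothing here is specific to Zilber's conjecture,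
and nothing about `EC(3,2)` (OPEN) or Schanuel's conjecture is asserted. [folklore]
-/

namespace Literature.ModelTheory.Zilber

open Module Matrix

variable {ι : Type*}

/-- A vector `v : ι → ℤ` is **primitive** when its coordinates generate the unit ideal
(equivalently: they are coprime; in particular `v ≠ 0` when `ι` is nonempty). [folklore] -/
def IsPrimitiveVec (v : ι → ℤ) : Prop := Ideal.span (Set.range v) = ⊤

/-- Bézout form of primitivity: `∑ cᵢ vᵢ = 1` for some integers `cᵢ`. [folklore] -/
theorem isPrimitiveVec_iff_exists_sum [Fintype ι] (v : ι → ℤ) :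
    IsPrimitiveVec v ↔ ∃ c : ι → ℤ, ∑ i, c i * v i = 1 := by
  rw [IsPrimitiveVec, Ideal.eq_top_iff_one, Ideal.mem_span_range_iff_exists_fun]

/-- A primitive vector has no non-unit common divisor. [folklore] -/
theorem IsPrimitiveVec.isUnit_of_dvd [Fintype ι] {v : ι → ℤ} (hv : IsPrimitiveVec v) {k : ℤ}
    (hk : ∀ i, k ∣ v i) : IsUnit k := by
  obtain ⟨c, hc⟩ := (isPrimitiveVec_iff_exists_sum v).1 hv
  have : k ∣ ∑ i, c i * v i := Finset.dvd_sum fun i _ => Dvd.dvd.mul_left (hk i) _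
  rw [hc] at this
  exact isUnit_of_dvd_one this

/-- Conversely, over `ℤ` a vector with no non-unit common divisor is primitive. [folklore] -/
theorem isPrimitiveVec_of_forall_isUnit {v : ι → ℤ}
    (h : ∀ k : ℤ, (∀ i, k ∣ v i) → IsUnit k) : IsPrimitiveVec v := by
  classical
  let I : Ideal ℤ := Ideal.span (Set.range v)
  have hI : I.IsPrincipal := IsPrincipalIdealRing.principal I
  have hg : ∀ i, Submodule.IsPrincipal.generator I ∣ v i := fun i =>
    (Submodule.IsPrincipal.mem_iff_generator_dvd I).1 (Ideal.subset_span ⟨i, rfl⟩)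
  have hu := h _ hg
  change I = ⊤
  rw [← Ideal.span_singleton_generator I, Ideal.span_singleton_eq_top]
  exact hu

/-- Every nonzero integer vector is an integer multiple of a primitive one. [folklore] -/
theorem exists_eq_smul_primitive [Fintype ι] {v : ι → ℤ} (hv : v ≠ 0) :
    ∃ (g : ℤ) (v' : ι → ℤ), g ≠ 0 ∧ v = g • v' ∧ IsPrimitiveVec v' := by
  classical
  let I : Ideal ℤ := Ideal.span (Set.range v)
  let g := Submodule.IsPrincipal.generator I
  have hg : ∀ i, g ∣ v i := fun i =>
    (Submodule.IsPrincipal.mem_iff_generator_dvd I).1 (Ideal.subset_span ⟨i, rfl⟩)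
  choose w hw using hg
  have hg0 : g ≠ 0 := by
    intro h0
    apply hv
    funext i
    rw [hw i, h0, zero_mul]; rfl
  refine ⟨g, w, hg0, funext fun i => by rw [hw i]; rfl, ?_⟩
  -- `g ∈ I = span (range (g • w))` gives `g = g * t` with `t ∈ span (range w)`, so `1 ∈ span (range w)`.
  have hgI : g ∈ I := Submodule.IsPrincipal.generator_mem I
  obtain ⟨c, hc⟩ := Ideal.mem_span_range_iff_exists_fun.1 hgI
  rw [isPrimitiveVec_iff_exists_sum]
  refine ⟨c, mul_left_cancel₀ hg0 ?_⟩
  rw [mul_one, Finset.mul_sum]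
  conv_rhs => rw [← hc]
  refine Finset.sum_congr rfl fun i _ => ?_
  rw [hw i]; ring

/-- **Unimodular completion, basis form**: a primitive `v : ι → ℤ` is the `i₀`-th vector of
some `ℤ`-basis of `ι → ℤ`, for any prescribed index `i₀`. Proof: a Bézout functional `φ` with
`φ v = 1` splits `ℤ^ι = ℤ v ⊕ ker φ`, and `ker φ` is free (submodule of a free module over a
PID). [folklore] -/
theorem exists_basis_apply_eq_of_primitive [Fintype ι] [DecidableEq ι] {v : ι → ℤ}
    (hv : IsPrimitiveVec v) (i₀ : ι) :
    ∃ b : Basis ι ℤ (ι → ℤ), b i₀ = v := by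
  classical
  obtain ⟨c, hc⟩ := (isPrimitiveVec_iff_exists_sum v).1 hv
  -- the Bézout functional
  let φ : (ι → ℤ) →ₗ[ℤ] ℤ :=
    { toFun := fun x => ∑ i, c i * x i
      map_add' := fun x y => by
        simp only [Pi.add_apply, mul_add, Finset.sum_add_distrib]
      map_smul' := fun r x => by
        simp only [Pi.smul_apply, smul_eq_mul, RingHom.id_apply, Finset.mul_sum]
        exact Finset.sum_congr rfl fun i _ => by ring }
  have hφv : φ v = 1 := hc
  -- the splitting `ℤ^ι ≃ ℤ × ker φ`
  let K := LinearMap.ker φ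
  have hmemK : ∀ x : ι → ℤ, x - φ x • v ∈ K := fun x => by
    change φ (x - φ x • v) = 0
    rw [map_sub, map_smul, hφv, smul_eq_mul, mul_one, sub_self]
  let e : (ι → ℤ) ≃ₗ[ℤ] ℤ × K :=
    { toFun := fun x => (φ x, ⟨x - φ x • v, hmemK x⟩)
      map_add' := fun x y => by
        refine Prod.ext (map_add φ x y) (Subtype.ext ?_)
        change x + y - φ (x + y) • v = (x - φ x • v) + (y - φ y • v)
        rw [map_add, add_smul]; abel
      map_smul' := fun r x => by
        refine Prod.ext (map_smul φ r x) (Subtype.ext ?_)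
        change r • x - φ (r • x) • v = r • (x - φ x • v)
        rw [map_smul, smul_eq_mul, mul_smul, smul_sub]
      invFun := fun p => p.1 • v + (p.2 : ι → ℤ)
      left_inv := fun x => by
        change φ x • v + (x - φ x • v) = x
        abel
      right_inv := fun p => by
        obtain ⟨t, y, hy⟩ := p
        have hy0 : φ y = 0 := hy
        have h1 : φ (t • v + y) = t := by
          rw [map_add, map_smul, hφv, hy0, smul_eq_mul, mul_one, add_zero]
        refine Prod.ext h1 (Subtype.ext ?_)
        change t • v + y - φ (t • v + y) • v = y
        rw [h1, add_sub_cancel_left] }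
  -- bases: `ℤ` by the singleton basis, `K` by `Submodule.basisOfPid`
  obtain ⟨n, bK⟩ := Submodule.basisOfPid (Pi.basisFun ℤ ι) K
  let b₁ : Basis (Unit ⊕ Fin n) ℤ (ℤ × K) := (Basis.singleton Unit ℤ).prod bK
  let b₀ : Basis (Unit ⊕ Fin n) ℤ (ι → ℤ) := b₁.map e.symm
  have hb₀ : b₀ (Sum.inl ()) = v := by
    change e.symm (b₁ (Sum.inl ())) = v
    have h1 : b₁ (Sum.inl ()) = (1, 0) := by
      ext
      · change (b₁ (Sum.inl ())).1 = 1
        rw [Basis.prod_apply_inl_fst, Basis.singleton_apply]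
      · change ((b₁ (Sum.inl ())).2 : ι → ℤ) _ = ((0 : K) : ι → ℤ) _
        rw [Basis.prod_apply_inl_snd]
    rw [h1]
    change (1 : ℤ) • v + ((0 : K) : ι → ℤ) = v
    rw [one_smul, Submodule.coe_zero, add_zero]
  -- reindex to `ι`, then move the distinguished index to `i₀`
  let σ : Unit ⊕ Fin n ≃ ι := b₀.indexEquiv (Pi.basisFun ℤ ι)
  let b₂ : Basis ι ℤ (ι → ℤ) := b₀.reindex σ
  have hb₂ : b₂ (σ (Sum.inl ())) = v := by
    simp only [b₂, Basis.reindex_apply, Equiv.symm_apply_apply, hb₀]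
  refine ⟨b₂.reindex (Equiv.swap (σ (Sum.inl ())) i₀), ?_⟩
  rw [Basis.reindex_apply, Equiv.symm_swap, Equiv.swap_apply_right, hb₂]

/-- **Unimodular completion, matrix form**: for a primitive `v : ι → ℤ` and any index `i₀` there
is an integer matrix `U` with unit determinant (`U ∈ GLₙ(ℤ)`) and `U v = e_{i₀}`. [folklore] -/
theorem exists_unimodular_mulVec_eq_single [Fintype ι] [DecidableEq ι] {v : ι → ℤ}
    (hv : IsPrimitiveVec v) (i₀ : ι) :
    ∃ U : Matrix ι ι ℤ, IsUnit U.det ∧ U *ᵥ v = Pi.single i₀ 1 := by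
  classical
  obtain ⟨b, hb⟩ := exists_basis_apply_eq_of_primitive hv i₀
  -- `P` = the matrix whose columns are the basis vectors `b j`; it is unimodular and `P e_{i₀} = v`.
  let P : Matrix ι ι ℤ := (Pi.basisFun ℤ ι).toMatrix b
  have hPdet : IsUnit P.det := by
    have h := (Pi.basisFun ℤ ι).isUnit_det b
    rwa [Basis.det_apply] at h
  have hPcol : P *ᵥ Pi.single i₀ 1 = v := by
    rw [Matrix.mulVec_single_one]
    funext i
    change (Pi.basisFun ℤ ι).toMatrix b i i₀ = v i
    rw [Basis.toMatrix_apply, Pi.basisFun_repr, hb]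
  refine ⟨P⁻¹, Matrix.isUnit_nonsing_inv_det P hPdet, ?_⟩
  rw [← hPcol, Matrix.mulVec_mulVec, Matrix.nonsing_inv_mul P hPdet, Matrix.one_mulVec]

/-- **Unimodular completion, column form**: a primitive `v` is the `i₀`-th column of a matrix
`P ∈ GLₙ(ℤ)`. [folklore] -/
theorem exists_unimodular_col_eq [Fintype ι] [DecidableEq ι] {v : ι → ℤ}
    (hv : IsPrimitiveVec v) (i₀ : ι) :
    ∃ P : Matrix ι ι ℤ, IsUnit P.det ∧ P.col i₀ = v := by
  classical
  obtain ⟨b, hb⟩ := exists_basis_apply_eq_of_primitive hv i₀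
  refine ⟨(Pi.basisFun ℤ ι).toMatrix b, ?_, ?_⟩
  · have h := (Pi.basisFun ℤ ι).isUnit_det b
    rwa [Basis.det_apply] at h
  · funext i
    change (Pi.basisFun ℤ ι).toMatrix b i i₀ = v i
    rw [Basis.toMatrix_apply, Pi.basisFun_repr, hb]

/-- The two-sided form used for coordinate changes: `U ∈ GLₙ(ℤ)` with `U v = e_{i₀}` and an
integer inverse `U⁻¹` with `U⁻¹ e_{i₀} = v`, `U⁻¹ U = U U⁻¹ = 1`. [folklore] -/
theorem exists_unimodular_pair_of_primitive [Fintype ι] [DecidableEq ι] {v : ι → ℤ}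
    (hv : IsPrimitiveVec v) (i₀ : ι) :
    ∃ U V : Matrix ι ι ℤ, U * V = 1 ∧ V * U = 1 ∧ U *ᵥ v = Pi.single i₀ 1 ∧
      V *ᵥ Pi.single i₀ 1 = v := by
  classical
  obtain ⟨U, hU, hUv⟩ := exists_unimodular_mulVec_eq_single hv i₀
  refine ⟨U, U⁻¹, Matrix.mul_nonsing_inv U hU, Matrix.nonsing_inv_mul U hU, hUv, ?_⟩
  rw [← hUv, Matrix.mulVec_mulVec, Matrix.nonsing_inv_mul U hU, Matrix.one_mulVec]

/-- Every nonzero integer vector is `g • (P e_{i₀})` for some `g ≠ 0` and `P ∈ GLₙ(ℤ)`: the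
normal form of a period direction. [folklore] -/
theorem exists_eq_smul_unimodular_col [Fintype ι] [DecidableEq ι] {v : ι → ℤ} (hv : v ≠ 0)
    (i₀ : ι) :
    ∃ (g : ℤ) (P : Matrix ι ι ℤ), g ≠ 0 ∧ IsUnit P.det ∧ v = g • P.col i₀ := by
  obtain ⟨g, v', hg, rfl, hv'⟩ := exists_eq_smul_primitive hv
  obtain ⟨P, hP, hcol⟩ := exists_unimodular_col_eq hv' i₀
  exact ⟨g, P, hg, hP, by rw [hcol]⟩

end Literature.ModelTheory.Zilber
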